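import Summits.Ventures.LatticeQCDFlow.TrivializingMaps.SpecificHeatCeilingTwoDim

/-!
HONEST FRAMING: exact (Metropolis-corrected) sampling algorithms for lattice gauge theory; figures
of merit are autocorrelation/cost numbers at stated couplings and volumes; no continuum-physics
claim.

# SpecificHeatFloorTwoDim — THE MATCHING TWO-DIMENSIONAL FLOOR WITH THE SAME STRUCTURAL RATE:
# `Var_{μ_β}(S_W^ρ) ≥ ½·e^{−4N|β|}·(L² − 1)·Var_Haar(Re tr ρ) − N²` on `(ℤ/L)²`, `L ≥ 2`, every real `β`, every
# compact gauge group — so in `d = 2` the specific heat per plaquette is PINCHED between `e^{−4N|β|}v_ρ/2 − N²/L²`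
# and `2N²e^{2N|β|}` (lean-2 GEN-12, ours)

Venture-side (OURS).  Cell `lqcd-flow` (pub-lqcd), unit `pub-lqcd-lean-2-g12`, 2026-08-23.  Companion of
`SpecificHeatCeilingTwoDim` (ceiling `2N²e^{2N|β|}L²`).  The tree's all-coupling FLOOR
(`WilsonVarianceFloorAllCouplings`, GEN-9) holds in every dimension but with the rate
`e^{−|β|·2NK(1+4K)}`, `K = (d+1)d²` (`= e^{−1176N|β|}` in `d = 2`) and the volume factor `⌊L/2⌋^d`; the
two-dimensional punctured-independence argument gives the floor with rate `e^{−4N|β|}` and volume factor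
`(L² − 1)/2`, by running the three steps of the ceiling BACKWARDS: (i) a tilt of oscillation `2K` also
DIVIDES nonnegative integrals by at most `e^{2K}` (`integral_tilted_ge_exp_neg_osc_mul`), so variances drop by
at most `e^{−2K}` under such a tilt (`variance_tilted_ge_exp_neg_osc_mul`); (ii) under the punctured measure
the off-puncture plaquette actions are independent with EQUAL one-plaquette variance `v₁(β)`, and
`v₁(β) ≥ e^{−2N|β|}·Var_Haar(Re tr ρ)` by (i) on one plaquette; (iii) `Var(S') ≤ 2Var(S_W) + 2N²`.

## What is proved (`(ℤ/L)²`, `L ≥ 2`, compact second-countable `G`, continuous `ρ : G →* M_N(ℂ)`, real `β`)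

* `integral_tilted_ge_exp_neg_osc_mul`, `variance_tilted_ge_exp_neg_osc_mul` (general tilted measures);
* `onePlaquette_variance_ge` — `Var_{Haar.tilted(−βs)}(s) ≥ e^{−2N|β|}·Var_Haar(Re tr ρ)`;
* `variance_punctured_ge` — `Var_{ν_β}(S') ≥ (L² − 1)·e^{−2N|β|}·Var_Haar(Re tr ρ)`;
* **`wilson_variance_ge_twoDim`** — `½·e^{−4N|β|}·(L² − 1)·Var_Haar(Re tr ρ) − N² ≤ Var_{μ_β}(S_W^ρ)`;
* **`wilson_ladder_necessary_twoDim_sharp`** — a monotone coupling ladder inside `[−B, B]` with adjacent swap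
  rates `≥ α` satisfies `(½e^{−4NB}(L²−1)v_ρ − N²)·(β_K − β_0)² ≤ 4K²·log(1/α)`: with
  `CouplingLadderLawTwoDim.wilson_ladder_sufficient_twoDim` the two-dimensional replica law reads
  `(b−a)·L·√(v_ρ/8)·e^{−2NB}/√log(1/α) ≲ K ≲ (b−a)·L·√2·N·e^{NB}·max(1, 3/log(1/α))`.

NOT CLAIMED: `d ≥ 3`; the true `β`-dependence (for `U(1)` row 5's exact variance); the continuum.
Literature grade: KNOWN MECHANISM, NEW TYPING; nothing is cited as a fact.
-/

noncomputable section

open MeasureTheory ProbabilityTheory Real Set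
open Literature.MathematicalPhysics.QuantumFieldTheory
open Literature.MathematicalPhysics.QuantumFieldTheory.Luscher2010
open Summit.Ventures.LatticeQCDFlow.Scaling
open Summit.Ventures.LatticeQCDFlow.Theory2.Lattice.TwoDim
open Literature.Probability.LatticeModels (integrable_of_continuous_compactSpace)

namespace Summit.Ventures.LatticeQCDFlow.TrivializingMaps

/-! ## §1 Reverse transfer under a bounded-oscillation tilt -/

section Tilted

variable {α : Type*} [MeasurableSpace α]

/-- **A bounded-oscillation tilt divides nonnegative integrals by at most `e^{2K}`**: if `|h − c| ≤ K` then
`e^{−2K} ∫ F dμ ≤ ∫ F d(μ.tilted h)` for every nonnegative `μ`-integrable `F` (probability measure `μ`).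
[folklore] -/
theorem integral_tilted_ge_exp_neg_osc_mul {μ : Measure α} [IsProbabilityMeasure μ] {h : α → ℝ}
    (hm : Measurable h) {c K : ℝ} (hb : ∀ x, |h x - c| ≤ K) {F : α → ℝ} (hF0 : ∀ x, 0 ≤ F x)
    (hFi : Integrable F μ) :
    exp (-(2 * K)) * ∫ x, F x ∂μ ≤ ∫ x, F x ∂(μ.tilted h) := by
  have hlo : ∀ x, c - K ≤ h x := fun x => by linarith [(abs_le.1 (hb x)).1]
  have hhi : ∀ x, h x ≤ c + K := fun x => by linarith [(abs_le.1 (hb x)).2]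
  have hint : Integrable (fun x => exp (h x)) μ :=
    Integrable.of_bound hm.exp.aestronglyMeasurable (exp (c + K))
      (ae_of_all _ fun x => by
        rw [Real.norm_eq_abs, abs_of_pos (exp_pos _)]
        exact exp_le_exp.2 (hhi x))
  have hZ : ∫ x, exp (h x) ∂μ ≤ exp (c + K) := by
    calc ∫ x, exp (h x) ∂μ ≤ ∫ _x, exp (c + K) ∂μ :=
          integral_mono hint (integrable_const _) fun x => exp_le_exp.2 (hhi x)
      _ = exp (c + K) := by simp
  have hZpos : 0 < ∫ x, exp (h x) ∂μ := integral_exp_pos hint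
  have hratio : ∀ x, exp (-(2 * K)) ≤ exp (h x) / ∫ x, exp (h x) ∂μ := by
    intro x
    rw [le_div_iff₀ hZpos]
    calc exp (-(2 * K)) * ∫ x, exp (h x) ∂μ ≤ exp (-(2 * K)) * exp (c + K) := by gcongr
      _ = exp (c - K) := by rw [← exp_add]; ring_nf
      _ ≤ exp (h x) := exp_le_exp.2 (hlo x)
  rw [integral_tilted, ← integral_const_mul]
  refine integral_mono_of_nonneg (ae_of_all _ fun x => mul_nonneg (exp_pos _).le (hF0 x)) ?_
    (ae_of_all _ fun x => ?_)
  · have hb' : ∀ x, exp (h x) / (∫ x, exp (h x) ∂μ) * F x ≤ exp (2 * K) * F x := fun x => by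
      refine mul_le_mul_of_nonneg_right ?_ (hF0 x)
      rw [div_le_iff₀ hZpos]
      calc exp (h x) ≤ exp (c + K) := exp_le_exp.2 (hhi x)
        _ = exp (2 * K) * exp (c - K) := by rw [← exp_add]; ring_nf
        _ ≤ exp (2 * K) * ∫ x, exp (h x) ∂μ := by
            gcongr
            calc exp (c - K) = ∫ _x, exp (c - K) ∂μ := by simp
              _ ≤ ∫ x, exp (h x) ∂μ := integral_mono (integrable_const _) hint fun x => exp_le_exp.2 (hlo x)
    refine Integrable.mono' (hFi.const_mul (exp (2 * K))) ?_ (ae_of_all _ fun x => ?_)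
    · exact ((hm.exp.div_const _).aestronglyMeasurable.smul hFi.aestronglyMeasurable)
    · rw [Real.norm_eq_abs, smul_eq_mul, abs_of_nonneg (mul_nonneg (div_nonneg (exp_pos _).le hZpos.le) (hF0 x))]
      exact hb' x
  · simp only [smul_eq_mul]
    exact mul_le_mul_of_nonneg_right (hratio x) (hF0 x)

/-- **Variances drop by at most `e^{−2K}` under a tilt of oscillation `2K`**: for a bounded continuous-type
observable `X` (measurable, `|X| ≤ C`) on a probability space and `|h − c| ≤ K`:
`e^{−2K}·Var_μ(X) ≤ Var_{μ.tilted h}(X)`. [folklore] -/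
theorem variance_tilted_ge_exp_neg_osc_mul {μ : Measure α} [IsProbabilityMeasure μ] {h : α → ℝ}
    (hm : Measurable h) {c K : ℝ} (hb : ∀ x, |h x - c| ≤ K) {X : α → ℝ} (hXm : Measurable X) {C : ℝ}
    (hXb : ∀ x, |X x| ≤ C) :
    exp (-(2 * K)) * variance X μ ≤ variance X (μ.tilted h) := by
  have hint : Integrable (fun x => exp (h x)) μ :=
    Integrable.of_bound hm.exp.aestronglyMeasurable (exp (c + K))
      (ae_of_all _ fun x => by
        rw [Real.norm_eq_abs, abs_of_pos (exp_pos _)]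
        exact exp_le_exp.2 (by linarith [(abs_le.1 (hb x)).2]))
  haveI : IsProbabilityMeasure (μ.tilted h) := isProbabilityMeasure_tilted hint
  set m : ℝ := ∫ x, X x ∂(μ.tilted h) with hm_def
  -- `Var_{μ'}(X) = ∫ (X − m)² dμ'`
  have h1 : variance X (μ.tilted h) = ∫ x, (X x - m) ^ 2 ∂(μ.tilted h) :=
    variance_eq_integral hXm.aemeasurable
  -- `Var_μ(X) ≤ ∫ (X − m)² dμ`
  have hFi : Integrable (fun x => (X x - m) ^ 2) μ :=
    Integrable.of_bound ((hXm.sub_const m).pow_const 2).aestronglyMeasurable ((C + |m|) ^ 2)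
      (ae_of_all _ fun x => by
        rw [Real.norm_eq_abs, abs_of_nonneg (sq_nonneg _), ← sq_abs]
        have h1 : |X x - m| ≤ C + |m| := (abs_sub _ _).trans (by linarith [hXb x])
        exact pow_le_pow_left₀ (abs_nonneg _) h1 2)
  have h2 : variance X μ ≤ ∫ x, (X x - m) ^ 2 ∂μ := by
    have h := variance_le_expectation_sq (μ := μ) (X := fun x => X x - m)
      (hXm.sub_const m).aestronglyMeasurable
    rw [variance_sub_const hXm.aestronglyMeasurable] at h
    simpa only [Pi.pow_apply] using h
  have h3 := integral_tilted_ge_exp_neg_osc_mul hm hb (fun x => sq_nonneg (X x - m)) hFi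
  rw [h1]
  calc exp (-(2 * K)) * variance X μ ≤ exp (-(2 * K)) * ∫ x, (X x - m) ^ 2 ∂μ :=
        mul_le_mul_of_nonneg_left h2 (exp_pos _).le
    _ ≤ ∫ x, (X x - m) ^ 2 ∂(μ.tilted h) := h3

end Tilted

/-! ## §2 The two-dimensional floor -/

section TwoDim

variable {L N : ℕ} [NeZero L] {G : Type*} [Group G] [TopologicalSpace G] [IsTopologicalGroup G]
  [CompactSpace G] [MeasurableSpace G] [BorelSpace G] [SecondCountableTopology G]
  (ρ : G →* Matrix (Fin N) (Fin N) ℂ)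

omit [NeZero L] [SecondCountableTopology G] in
/-- **One plaquette**: `Var_{Haar.tilted(−βs)}(s) ≥ e^{−2N|β|}·Var_Haar(Re tr ρ)`, `s = N − Re tr ρ`. [ours] -/
theorem onePlaquette_variance_ge (hρ : Continuous ρ) (β : ℝ) :
    exp (-(2 * (N * |β|))) * variance (fun g : G => (ρ g).trace.re) (haarProbability G) ≤
      variance (fun g : G => (N : ℝ) - (ρ g).trace.re)
        ((haarProbability G).tilted fun g => -(β * ((N : ℝ) - (ρ g).trace.re))) := by
  have hs_cont : Continuous fun g : G => (N : ℝ) - (ρ g).trace.re := continuous_plaqTerm ρ hρ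
  have hs_abs : ∀ g : G, |((N : ℝ) - (ρ g).trace.re) - N| ≤ N := fun g => by
    have h := plaqTerm_mem_Icc ρ hρ g
    rw [abs_le]; constructor <;> linarith [h.1, h.2]
  have hK : ∀ g : G, |-(β * ((N : ℝ) - (ρ g).trace.re)) - (-(β * N))| ≤ N * |β| := by
    intro g
    have : -(β * ((N : ℝ) - (ρ g).trace.re)) - (-(β * N)) = -(β * (((N : ℝ) - (ρ g).trace.re) - N)) := by
      ring
    rw [this, abs_neg, abs_mul, mul_comm]
    exact mul_le_mul_of_nonneg_right (hs_abs g) (abs_nonneg β)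
  have hXb : ∀ g : G, |(N : ℝ) - (ρ g).trace.re| ≤ 2 * N := fun g => by
    have h := plaqTerm_mem_Icc ρ hρ g
    rw [abs_le]; constructor <;> linarith [h.1, h.2]
  have h := variance_tilted_ge_exp_neg_osc_mul (μ := haarProbability G)
    (continuous_const.mul hs_cont).neg.measurable hK hs_cont.measurable hXb
  have hv : variance (fun g : G => (N : ℝ) - (ρ g).trace.re) (haarProbability G) =
      variance (fun g : G => (ρ g).trace.re) (haarProbability G) :=
    variance_const_sub (Complex.continuous_re.comp hρ.matrix_trace).aestronglyMeasurable _
  rw [hv] at h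
  exact h

/-- **The punctured variance from below**: `Var_{ν_β}(S') ≥ (L² − 1)·e^{−2N|β|}·Var_Haar(Re tr ρ)`
(independence of the `L² − 1` off-puncture plaquettes, each with the one-plaquette variance). [ours] -/
theorem variance_punctured_ge (hL : 2 ≤ L) (hρ : Continuous ρ) (x₀ : Site 2 L) (β : ℝ) :
    ((L : ℝ) ^ 2 - 1) * (exp (-(2 * (N * |β|))) * variance (fun g : G => (ρ g).trace.re) (haarProbability G)) ≤
    variance (fun U : GaugeConfig 2 L G => ∑ i : {x : Site 2 L // x ≠ x₀},
        ((N : ℝ) - (ρ (plaquetteHolonomy U i.1 0 1)).trace.re))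
      ((trivialMeasure G 2 L).tilted fun U => ∑ i : {x : Site 2 L // x ≠ x₀},
        -(β * ((N : ℝ) - (ρ (plaquetteHolonomy U i.1 0 1)).trace.re))) := by
  classical
  set s : G → ℝ := fun g => (N : ℝ) - (ρ g).trace.re with hs_def
  set π₁ : Measure G := (haarProbability G).tilted fun g => -(β * s g) with hπ₁
  have hs_cont : Continuous s := continuous_plaqTerm ρ hρ
  have hs_mem : ∀ g, s g ∈ Icc (0 : ℝ) (2 * N) := fun g => plaqTerm_mem_Icc ρ hρ g
  haveI : IsProbabilityMeasure π₁ := isProbabilityMeasure_tilted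
    (integrable_of_continuous_compactSpace (haarProbability G)
      (continuous_exp.comp (continuous_const.mul hs_cont).neg))
  let Φ : GaugeConfig 2 L G → ({x : Site 2 L // x ≠ x₀} → G) := fun U i => plaquetteHolonomy U i.1 0 1
  have hΦ : Measurable Φ := measurable_pi_lambda _ fun i => measurable_plaquetteHolonomy i.1
  let T : ({x : Site 2 L // x ≠ x₀} → G) → ℝ := ∑ i, fun ω => s (ω i)
  have hT : ∀ ω, T ω = ∑ i, s (ω i) := fun ω => by simp only [T, Finset.sum_apply]
  have hTc : Continuous T :=
    (continuous_finsetSum _ fun i _ => hs_cont.comp (continuous_apply i)).congr fun ω => (hT ω).symm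
  have hobs : (fun U : GaugeConfig 2 L G => ∑ i : {x : Site 2 L // x ≠ x₀},
      ((N : ℝ) - (ρ (plaquetteHolonomy U i.1 0 1)).trace.re)) = T ∘ Φ := by
    funext U; rw [Function.comp_apply, hT]
  rw [hobs, ← variance_map hTc.measurable.aemeasurable hΦ.aemeasurable, map_punctured_eq_pi ρ hL hρ x₀ β]
  have hmem : ∀ _i : {x : Site 2 L // x ≠ x₀}, MemLp s 2 π₁ := fun _ =>
    MemLp.of_bound hs_cont.aestronglyMeasurable (2 * N) (ae_of_all _ fun g => by
      have h := hs_mem g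
      rw [Real.norm_eq_abs, abs_le]; constructor <;> linarith [h.1, h.2])
  have hsum := variance_sum_pi (μ := fun _ : {x : Site 2 L // x ≠ x₀} => π₁)
    (X := fun _ : {x : Site 2 L // x ≠ x₀} => s) hmem
  rw [show (∑ i, fun ω : {x : Site 2 L // x ≠ x₀} → G => (fun _ : {x : Site 2 L // x ≠ x₀} => s) i (ω i))
      = T from rfl] at hsum
  rw [show (fun _ : {x : Site 2 L // x ≠ x₀} =>
      (haarProbability G).tilted fun g => -(β * ((N : ℝ) - (ρ g).trace.re))) = fun _ => π₁ from rfl, hsum,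
    Finset.sum_const, Finset.card_univ, nsmul_eq_mul]
  have hv1 : exp (-(2 * (N * |β|))) * variance (fun g : G => (ρ g).trace.re) (haarProbability G) ≤
      variance s π₁ := onePlaquette_variance_ge ρ hρ β
  have hcard : (L : ℝ) ^ 2 - 1 ≤ (Fintype.card {x : Site 2 L // x ≠ x₀} : ℝ) := by
    have h1 : Fintype.card {x : Site 2 L // x ≠ x₀} = Fintype.card (Site 2 L) - 1 := by
      rw [Fintype.card_subtype_compl, Fintype.card_subtype_eq]
    have hS : Fintype.card (Site 2 L) = L ^ 2 := by
      rw [Fintype.card_fun, ZMod.card, Fintype.card_fin]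
    have hL1 : 1 ≤ L ^ 2 := Nat.one_le_pow _ _ (by omega)
    rw [h1, hS, Nat.cast_sub hL1]
    push_cast
    exact le_rfl
  have hv0 : 0 ≤ exp (-(2 * (N * |β|))) * variance (fun g : G => (ρ g).trace.re) (haarProbability G) :=
    mul_nonneg (exp_pos _).le (variance_nonneg _ _)
  calc ((L : ℝ) ^ 2 - 1) * (exp (-(2 * (N * |β|))) * variance (fun g : G => (ρ g).trace.re) (haarProbability G))
      ≤ (Fintype.card {x : Site 2 L // x ≠ x₀} : ℝ) *
          (exp (-(2 * (N * |β|))) * variance (fun g : G => (ρ g).trace.re) (haarProbability G)) :=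
        mul_le_mul_of_nonneg_right hcard hv0
    _ ≤ (Fintype.card {x : Site 2 L // x ≠ x₀} : ℝ) * variance s π₁ :=
        mul_le_mul_of_nonneg_left hv1 (Nat.cast_nonneg _)

/-- **MAIN THEOREM — THE TWO-DIMENSIONAL SPECIFIC-HEAT FLOOR WITH STRUCTURAL RATE `e^{−4N|β|}`**: on
`(ℤ/L)²`, `L ≥ 2`, for every continuous representation `ρ` of a compact group and every real `β`,
`½·e^{−4N|β|}·(L² − 1)·Var_Haar(Re tr ρ) − N² ≤ Var_{μ_β}(S_W^ρ)`. [ours] -/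
theorem wilson_variance_ge_twoDim (hL : 2 ≤ L) (hρ : Continuous ρ) (β : ℝ) :
    exp (-(4 * N * |β|)) * ((L : ℝ) ^ 2 - 1) * variance (fun g : G => (ρ g).trace.re) (haarProbability G) / 2
        - (N : ℝ) ^ 2 ≤
      variance (wilsonAction (d := 2) (L := L) ρ) (wilsonMeasure (d := 2) (L := L) ρ β) := by
  classical
  set s : G → ℝ := fun g => (N : ℝ) - (ρ g).trace.re with hs_def
  have hs_cont : Continuous s := continuous_plaqTerm ρ hρ
  have hs_abs : ∀ g, |s g - N| ≤ N := fun g => by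
    have h := plaqTerm_mem_Icc ρ hρ g
    rw [abs_le]; constructor <;> linarith [h.1, h.2]
  let x₀ : Site 2 L := 0
  set S' : GaugeConfig 2 L G → ℝ := fun U => ∑ i : {x : Site 2 L // x ≠ x₀},
      ((N : ℝ) - (ρ (plaquetteHolonomy U i.1 0 1)).trace.re) with hS'
  set ν : Measure (GaugeConfig 2 L G) := (trivialMeasure G 2 L).tilted fun U =>
      ∑ i : {x : Site 2 L // x ≠ x₀}, -(β * ((N : ℝ) - (ρ (plaquetteHolonomy U i.1 0 1)).trace.re))
    with hν
  have hS'c : Continuous S' :=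
    continuous_finsetSum _ fun i _ => (continuous_plaqTerm ρ hρ).comp
      ((continuous_apply i).comp (continuous_holonomies_ne (G := G) x₀))
  have hνc : Continuous fun U : GaugeConfig 2 L G => ∑ i : {x : Site 2 L // x ≠ x₀},
      -(β * ((N : ℝ) - (ρ (plaquetteHolonomy U i.1 0 1)).trace.re)) :=
    continuous_finsetSum _ fun i _ => (continuous_const.mul ((continuous_plaqTerm ρ hρ).comp
      ((continuous_apply i).comp (continuous_holonomies_ne (G := G) x₀)))).neg
  haveI : IsProbabilityMeasure (trivialMeasure G 2 L) := trivialMeasure_isProbabilityMeasure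
  haveI : IsProbabilityMeasure ν :=
    isProbabilityMeasure_tilted (integrable_trivialMeasure_of_continuous_group (continuous_exp.comp hνc))
  haveI := isProbabilityMeasure_wilsonMeasure (d := 2) (L := L) ρ hρ β
  have hSc : Continuous (wilsonAction (d := 2) (L := L) ρ) := continuous_wilsonAction_of_continuous ρ hρ
  have hhol₀c : Continuous fun U : GaugeConfig 2 L G => plaquetteHolonomy U x₀ 0 1 := by
    unfold plaquetteHolonomy; fun_prop
  have hS'b : ∀ U, |S' U| ≤ Fintype.card {x : Site 2 L // x ≠ x₀} * (2 * N) := by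
    intro U
    calc |S' U| ≤ ∑ i : {x : Site 2 L // x ≠ x₀}, |((N : ℝ) - (ρ (plaquetteHolonomy U i.1 0 1)).trace.re)| :=
          Finset.abs_sum_le_sum_abs _ _
      _ ≤ ∑ _i : {x : Site 2 L // x ≠ x₀}, (2 * (N : ℝ)) := Finset.sum_le_sum fun i _ => by
          have h := plaqTerm_mem_Icc ρ hρ (plaquetteHolonomy U i.1 0 1)
          rw [abs_le]; constructor <;> linarith [h.1, h.2]
      _ = Fintype.card {x : Site 2 L // x ≠ x₀} * (2 * N) := by
          rw [Finset.sum_const, Finset.card_univ, nsmul_eq_mul]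
  -- (ii)+(i): `Var_{μ_β}(S') ≥ e^{−2N|β|}·Var_ν(S') ≥ e^{−2N|β|}·(L²−1)·e^{−2N|β|}·v_ρ`
  have hK : ∀ U : GaugeConfig 2 L G,
      |-(β * ((N : ℝ) - (ρ (plaquetteHolonomy U x₀ 0 1)).trace.re)) - (-(β * N))| ≤ N * |β| := by
    intro U
    have : -(β * ((N : ℝ) - (ρ (plaquetteHolonomy U x₀ 0 1)).trace.re)) - (-(β * N)) =
        -(β * (s (plaquetteHolonomy U x₀ 0 1) - N)) := by simp only [hs_def]; ring
    rw [this, abs_neg, abs_mul, mul_comm]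
    exact mul_le_mul_of_nonneg_right (hs_abs _) (abs_nonneg β)
  have hstep1 : exp (-(2 * (N * |β|))) * variance S' ν ≤
      variance S' (wilsonMeasure (d := 2) (L := L) ρ β) := by
    rw [wilsonMeasure_two_eq_tilted_punctured ρ hρ x₀ β, ← hν]
    exact variance_tilted_ge_exp_neg_osc_mul (μ := ν)
      ((continuous_const.mul ((continuous_plaqTerm ρ hρ).comp hhol₀c)).neg.measurable) hK
      hS'c.measurable hS'b
  have hstep2 : ((L : ℝ) ^ 2 - 1) * (exp (-(2 * (N * |β|))) *
      variance (fun g : G => (ρ g).trace.re) (haarProbability G)) ≤ variance S' ν :=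
    variance_punctured_ge ρ hL hρ x₀ β
  -- (iii): `Var(S') ≤ 2·Var(S_W) + 2N²` under `μ_β`
  set mS : ℝ := ∫ U, wilsonAction ρ U ∂(wilsonMeasure (d := 2) (L := L) ρ β) with hmS
  set m0 : ℝ := ∫ U, s (plaquetteHolonomy U x₀ 0 1) ∂(wilsonMeasure (d := 2) (L := L) ρ β) with hm0
  have hint_S : Integrable (fun U => (wilsonAction ρ U - mS) ^ 2) (wilsonMeasure (d := 2) (L := L) ρ β) :=
    integrable_of_continuous_compactSpace _ ((hSc.sub continuous_const).pow 2)
  have hint_0 : Integrable (fun U => (s (plaquetteHolonomy U x₀ 0 1) - m0) ^ 2)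
      (wilsonMeasure (d := 2) (L := L) ρ β) :=
    integrable_of_continuous_compactSpace _ (((hs_cont.comp hhol₀c).sub continuous_const).pow 2)
  have hint_S' : Integrable (fun U => (S' U - (mS - m0)) ^ 2) (wilsonMeasure (d := 2) (L := L) ρ β) :=
    integrable_of_continuous_compactSpace _ ((hS'c.sub continuous_const).pow 2)
  have hpt : ∀ U : GaugeConfig 2 L G, (S' U - (mS - m0)) ^ 2 ≤
      2 * (wilsonAction ρ U - mS) ^ 2 + 2 * (s (plaquetteHolonomy U x₀ 0 1) - m0) ^ 2 := by
    intro U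
    have hdec : S' U - (mS - m0) = (wilsonAction ρ U - mS) - (s (plaquetteHolonomy U x₀ 0 1) - m0) := by
      rw [wilsonAction_two_eq_add_sum_ne ρ x₀ U]; simp only [hS', hs_def]; ring
    rw [hdec]
    nlinarith [sq_nonneg ((wilsonAction ρ U - mS) + (s (plaquetteHolonomy U x₀ 0 1) - m0))]
  have hstep3 : variance S' (wilsonMeasure (d := 2) (L := L) ρ β) ≤
      2 * variance (wilsonAction (d := 2) (L := L) ρ) (wilsonMeasure (d := 2) (L := L) ρ β) + 2 * (N : ℝ) ^ 2 := by
    have hv : variance S' (wilsonMeasure (d := 2) (L := L) ρ β) ≤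
        ∫ U, (S' U - (mS - m0)) ^ 2 ∂(wilsonMeasure (d := 2) (L := L) ρ β) := by
      have h := variance_le_expectation_sq (μ := wilsonMeasure (d := 2) (L := L) ρ β)
        (X := fun U => S' U - (mS - m0)) (hS'c.sub continuous_const).aestronglyMeasurable
      rw [variance_sub_const hS'c.aestronglyMeasurable] at h
      simpa only [Pi.pow_apply] using h
    have hvS : ∫ U, (wilsonAction ρ U - mS) ^ 2 ∂(wilsonMeasure (d := 2) (L := L) ρ β) =
        variance (wilsonAction (d := 2) (L := L) ρ) (wilsonMeasure (d := 2) (L := L) ρ β) := by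
      rw [variance_eq_integral hSc.measurable.aemeasurable]
    have hmeas0 : Measurable fun U : GaugeConfig 2 L G => s (plaquetteHolonomy U x₀ 0 1) :=
      (hs_cont.comp hhol₀c).measurable
    have h0eq : variance (fun U => s (plaquetteHolonomy U x₀ 0 1)) (wilsonMeasure (d := 2) (L := L) ρ β) =
        ∫ U, (s (plaquetteHolonomy U x₀ 0 1) - m0) ^ 2 ∂(wilsonMeasure (d := 2) (L := L) ρ β) := by
      rw [variance_eq_integral (X := fun U => s (plaquetteHolonomy U x₀ 0 1)) hmeas0.aemeasurable]
    have hv0 : ∫ U, (s (plaquetteHolonomy U x₀ 0 1) - m0) ^ 2 ∂(wilsonMeasure (d := 2) (L := L) ρ β) ≤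
        (N : ℝ) ^ 2 := by
      rw [← h0eq]
      have h := variance_le_sq_of_bounded (μ := wilsonMeasure (d := 2) (L := L) ρ β)
        (X := fun U => s (plaquetteHolonomy U x₀ 0 1))
        (ae_of_all _ fun U => plaqTerm_mem_Icc ρ hρ (plaquetteHolonomy U x₀ 0 1)) hmeas0.aemeasurable
      calc _ ≤ ((2 * (N : ℝ) - 0) / 2) ^ 2 := h
        _ = (N : ℝ) ^ 2 := by ring
    have hI : ∫ U, (S' U - (mS - m0)) ^ 2 ∂(wilsonMeasure (d := 2) (L := L) ρ β) ≤
        ∫ U, (2 * (wilsonAction ρ U - mS) ^ 2 + 2 * (s (plaquetteHolonomy U x₀ 0 1) - m0) ^ 2)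
          ∂(wilsonMeasure (d := 2) (L := L) ρ β) :=
      integral_mono hint_S' ((hint_S.const_mul 2).add (hint_0.const_mul 2)) hpt
    have hsum : ∫ U, (2 * (wilsonAction ρ U - mS) ^ 2 + 2 * (s (plaquetteHolonomy U x₀ 0 1) - m0) ^ 2)
          ∂(wilsonMeasure (d := 2) (L := L) ρ β) =
        2 * ∫ U, (wilsonAction ρ U - mS) ^ 2 ∂(wilsonMeasure (d := 2) (L := L) ρ β) +
          2 * ∫ U, (s (plaquetteHolonomy U x₀ 0 1) - m0) ^ 2 ∂(wilsonMeasure (d := 2) (L := L) ρ β) := by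
      rw [integral_add (hint_S.const_mul 2) (hint_0.const_mul 2), integral_const_mul, integral_const_mul]
    rw [hsum, hvS] at hI
    linarith
  -- assemble
  have hexp : exp (-(4 * N * |β|)) = exp (-(2 * (N * |β|))) * exp (-(2 * (N * |β|))) := by
    rw [← exp_add]; ring_nf
  have hv0 : 0 ≤ variance (fun g : G => (ρ g).trace.re) (haarProbability G) := variance_nonneg _ _
  have hchain : exp (-(4 * N * |β|)) * ((L : ℝ) ^ 2 - 1) *
      variance (fun g : G => (ρ g).trace.re) (haarProbability G) ≤
      variance S' (wilsonMeasure (d := 2) (L := L) ρ β) := by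
    calc exp (-(4 * N * |β|)) * ((L : ℝ) ^ 2 - 1) * variance (fun g : G => (ρ g).trace.re) (haarProbability G)
        = exp (-(2 * (N * |β|))) * (((L : ℝ) ^ 2 - 1) * (exp (-(2 * (N * |β|))) *
            variance (fun g : G => (ρ g).trace.re) (haarProbability G))) := by rw [hexp]; ring
      _ ≤ exp (-(2 * (N * |β|))) * variance S' ν := mul_le_mul_of_nonneg_left hstep2 (exp_pos _).le
      _ ≤ variance S' (wilsonMeasure (d := 2) (L := L) ρ β) := hstep1
  linarith

/-- **LADDER NECESSITY IN `d = 2` WITH THE SHARPER FLOOR**: a monotone coupling ladder inside `[−B, B]` with all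
adjacent swap rates `≥ α > 0` satisfies `(½e^{−4NB}(L²−1)·Var_Haar(Re tr ρ) − N²)·(β_K − β_0)² ≤ 4K²·log(1/α)`
(whenever the bracket is nonnegative). [ours] -/
theorem wilson_ladder_necessary_twoDim_sharp (hL : 2 ≤ L) (hρ : Continuous ρ) (K : ℕ) (β : ℕ → ℝ)
    (hβ : Monotone β) {B : ℝ} (hlo : -B ≤ β 0) (hhi : β K ≤ B) {α : ℝ} (hα : 0 < α)
    (hm0 : 0 ≤ exp (-(4 * N * B)) * ((L : ℝ) ^ 2 - 1) *
      variance (fun g : G => (ρ g).trace.re) (haarProbability G) / 2 - (N : ℝ) ^ 2)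
    (hacc : ∀ j < K, α ≤ swapAcc (fun U => -wilsonAction ρ U) (trivialMeasure G 2 L) (β j) (β (j + 1))) :
    (exp (-(4 * N * B)) * ((L : ℝ) ^ 2 - 1) * variance (fun g : G => (ρ g).trace.re) (haarProbability G) / 2
        - (N : ℝ) ^ 2) * (β K - β 0) ^ 2 ≤ 4 * (K : ℝ) ^ 2 * log (1 / α) := by
  refine wilson_ladder_necessary (d := 2) (L := L) ρ hρ hm0 K β hβ (fun u hu => ?_) hα hacc
  refine le_trans ?_ (wilson_variance_ge_twoDim ρ hL hρ u)
  have hu : |u| ≤ B := abs_le.2 ⟨by linarith [hu.1], by linarith [hu.2]⟩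
  have hL1 : (0 : ℝ) ≤ (L : ℝ) ^ 2 - 1 := by
    have : (2 : ℝ) ≤ L := by exact_mod_cast hL
    nlinarith
  have hv0 : 0 ≤ variance (fun g : G => (ρ g).trace.re) (haarProbability G) := variance_nonneg _ _
  have hN : (0 : ℝ) ≤ N := Nat.cast_nonneg N
  have he : exp (-(4 * N * B)) ≤ exp (-(4 * N * |u|)) := exp_le_exp.2 (by nlinarith)
  have := mul_le_mul_of_nonneg_right (mul_le_mul_of_nonneg_right he hL1) hv0
  linarith

end TwoDim

end Summit.Ventures.LatticeQCDFlow.TrivializingMaps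

end
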